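import Summits.KontsevichZagierPeriods.KontsevichZagierPeriods.Theorems.SoloInformedTelescopeMoves
import Summits.KontsevichZagierPeriods.KontsevichZagierPeriods.Theorems.SoloInformedZetaOneTwoReps
import HarnessLib
import HarnessLib.Audit

/-!
# SoloInformed — Euler's `ζ(1,2) = ζ(3)` is a Kontsevich–Zagier relation

Solo programme `solo-KontsevichZagierPeriods-informed`, session s45 (PART XVI). **Main theorem**
`soloInformed_zeta12_sub_zeta3_mem_relations`:

  `[T, 1/(t₀(1−t₁)(1−t₂))] − [T, 1/(t₀t₁(1−t₂))] ∈ KZ.relations`,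

`T = {1 > t₀ > t₁ > t₂ > 0}`, i.e. the iterated-integral representations of `ζ(1,2)` and `ζ(3)`
are equivalent in the formal period algebra `𝒫 = ℤ[reps]/relations`; both are `IsRational`
representations, so this is an unconditional instance of `KZPeriodConjecture` on the weight-3
multiple-zeta sector (paper COR XVI.4). The derivation uses the telescope
`soloInformed_telescope` (a regularised double-shuffle relation realised by naive moves) plus seven
elementary moves: `R₂ = Z₁₂ᶜ + Z₃ᶜ` (1b), `Z₁₂ᶜ ≡ Z₁₂ˢ`, `Z₃ᶜ ≡ Z₃ˢ` (2, along
`κ = (x₀,x₀x₁,x₀x₁x₂)`), `R₁ = P₁ + P₂` (1a, wall `{w = yu}` null), `P₁ ≡ Z₁₂ˢ`, `P₂ ≡ Z₁₂ˢ`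
(2, along `(u,yu,w)` and `(u,w,yu)`).

References: M. Kontsevich, D. Zagier, *Periods* (2001), §1.1–1.2 [KontsevichZagier2001];
L. Euler (1775), `ζ(2,1) = ζ(3)`.
-/

noncomputable section

open MeasureTheory Set MvPolynomial
open Literature.ModelTheory.ExponentialFields Literature.NumberTheory.Transcendental
open Literature.NumberTheory.Transcendental.KZ

namespace Summit.KontsevichZagierPeriods.KontsevichZagierPeriods.Theorems

/-! ## 1. The simplicial representations of `ζ(1,2)` and `ζ(3)` -/

/-- `1/(t₀(1−t₁)(1−t₂))`. -/
def soloInformedZ12s (t : Fin 3 → ℝ) : ℝ := 1 / (t 0 * (1 - t 1) * (1 - t 2))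
/-- `1/(t₀t₁(1−t₂))`. -/
def soloInformedZ3s (t : Fin 3 → ℝ) : ℝ := 1 / (t 0 * t 1 * (1 - t 2))

/-- Auxiliary (ζ(1,2) = ζ(3)): `soloInformedTelT_subset`. -/
theorem soloInformedTelT_subset : soloInformedTelT ⊆ soloInformedOpenCube 3 := inter_subset_left

/-- Auxiliary (ζ(1,2) = ζ(3)): `soloInformed_measurableSet_telT`. -/
theorem soloInformed_measurableSet_telT : MeasurableSet soloInformedTelT :=
  soloInformed_measurableSet_openCube3.inter
    ((measurableSet_lt (measurable_pi_apply 1) (measurable_pi_apply 0)).inter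
      (measurableSet_lt (measurable_pi_apply 2) (measurable_pi_apply 1)))

section pull
variable {x : Fin 3 → ℝ}

/-- `|det J_κ| · Z₁₂ˢ ∘ κ = Z₁₂ᶜ` on the cube. -/
theorem soloInformedZ12s_kap (hx : x ∈ soloInformedOpenCube 3) :
    |(soloInformedJacCLM soloInformedTelKapPoly x).det| * soloInformedZ12s (soloInformedTelKap x) =
      soloInformedZ12c x := by
  have h0 := hx 0; have h1 := hx 1
  rw [soloInformed_det_telKap, abs_of_pos (mul_pos (mul_pos h0.1 h0.1) h1.1), soloInformedZ12s,
    soloInformedTelKap_zero, soloInformedTelKap_one, soloInformedTelKap_two, soloInformedZ12c]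
  set a := 1 - x 0 * x 1 with ha_def
  set b := 1 - x 0 * x 1 * x 2 with hb_def
  have ha : a ≠ 0 := (soloInformed_one_sub_yu_pos hx).ne'
  have hb : b ≠ 0 := (soloInformed_one_sub_yuw_pos hx).ne'
  have hy : x 0 ≠ 0 := h0.1.ne'
  field_simp

/-- `|det J_κ| · Z₃ˢ ∘ κ = Z₃ᶜ` on the cube. -/
theorem soloInformedZ3s_kap (hx : x ∈ soloInformedOpenCube 3) :
    |(soloInformedJacCLM soloInformedTelKapPoly x).det| * soloInformedZ3s (soloInformedTelKap x) =
      soloInformedZ3c x := by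
  have h0 := hx 0; have h1 := hx 1
  rw [soloInformed_det_telKap, abs_of_pos (mul_pos (mul_pos h0.1 h0.1) h1.1), soloInformedZ3s,
    soloInformedTelKap_zero, soloInformedTelKap_one, soloInformedTelKap_two, soloInformedZ3c]
  set b := 1 - x 0 * x 1 * x 2 with hb_def
  have hb : b ≠ 0 := (soloInformed_one_sub_yuw_pos hx).ne'
  have hy : x 0 ≠ 0 := h0.1.ne'
  have hu : x 1 ≠ 0 := h1.1.ne'
  field_simp

/-- `|det J_{M₁}| · Z₁₂ˢ ∘ M₁ = f₁` and `|det J_{M₂}| · Z₁₂ˢ ∘ M₂ = f₁` on the cube. -/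
theorem soloInformedZ12s_m1 (hx : x ∈ soloInformedOpenCube 3) :
    soloInformedZ12s (soloInformedTelM1 x) * |(soloInformedJacCLM soloInformedTelM1Poly x).det| =
      soloInformedTelF1 x := by
  have h1 := hx 1
  rw [soloInformed_det_telM1, abs_neg, abs_of_pos h1.1, soloInformedZ12s, soloInformedTelM1_zero,
    soloInformedTelM1_one, soloInformedTelM1_two, soloInformedTelF1]
  set a := 1 - x 0 * x 1 with ha_def
  set c := 1 - x 2 with hc_def
  have ha : a ≠ 0 := (soloInformed_one_sub_yu_pos hx).ne'
  have hc : c ≠ 0 := (soloInformed_one_sub_w_pos hx).ne'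
  have hu : x 1 ≠ 0 := h1.1.ne'
  field_simp

/-- Auxiliary (ζ(1,2) = ζ(3)): `soloInformedZ12s_m2`. -/
theorem soloInformedZ12s_m2 (hx : x ∈ soloInformedOpenCube 3) :
    soloInformedZ12s (soloInformedTelM2 x) * |(soloInformedJacCLM soloInformedTelM2Poly x).det| =
      soloInformedTelF1 x := by
  have h1 := hx 1
  rw [soloInformed_det_telM2, abs_of_pos h1.1, soloInformedZ12s, soloInformedTelM2_zero,
    soloInformedTelM2_one, soloInformedTelM2_two, soloInformedTelF1]
  set a := 1 - x 0 * x 1 with ha_def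
  set c := 1 - x 2 with hc_def
  have ha : a ≠ 0 := (soloInformed_one_sub_yu_pos hx).ne'
  have hc : c ≠ 0 := (soloInformed_one_sub_w_pos hx).ne'
  have hu : x 1 ≠ 0 := h1.1.ne'
  field_simp

end pull

/-- Denominators on `T`. -/
theorem soloInformedZ12s_den_pos {t : Fin 3 → ℝ} (ht : t ∈ soloInformedTelT) :
    0 < t 0 * (1 - t 1) * (1 - t 2) :=
  mul_pos (mul_pos (ht.1 0).1 (by linarith [(ht.1 1).2])) (by linarith [(ht.1 2).2])

/-- Auxiliary (ζ(1,2) = ζ(3)): `soloInformedZ3s_den_pos`. -/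
theorem soloInformedZ3s_den_pos {t : Fin 3 → ℝ} (ht : t ∈ soloInformedTelT) :
    0 < t 0 * t 1 * (1 - t 2) :=
  mul_pos (mul_pos (ht.1 0).1 (ht.1 1).1) (by linarith [(ht.1 2).2])

/-- **`Z₁₂ˢ = [T, 1/(t₀(1−t₁)(1−t₂))]`**, the iterated-integral representation of `ζ(1,2)`;
integrable by transport of `Z₁₂ᶜ` along `κ`. -/
def soloInformedZ12sRep : IntegralRep 3 where
  domain := soloInformedTelT
  integrand := soloInformedZ12s
  isSemialgebraic_domain := isSemialgebraic_soloInformedTelT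
  isSemialgebraicFunOn_integrand :=
    soloInformed_isSemialgebraicFunOn_quot3 isSemialgebraic_soloInformedTelT 1
      (X 0 * (1 - X 1) * (1 - X 2)) _ (fun t ht => by simpa using (soloInformedZ12s_den_pos ht).ne')
      fun t _ => by simp [soloInformedZ12s]
  integrableOn := by
    rw [← soloInformed_image_telKap, soloInformedTelKap, soloInformed_integrableOn_image_polyMap_iff
      _ soloInformed_measurableSet_openCube3 soloInformed_injOn_telKap]
    exact soloInformedZ12cRep.integrableOn.congr_fun (fun x hx => (soloInformedZ12s_kap hx).symm)
      soloInformed_measurableSet_openCube3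

/-- **`Z₃ˢ = [T, 1/(t₀t₁(1−t₂))]`**, the iterated-integral representation of `ζ(3)`. -/
def soloInformedZ3sRep : IntegralRep 3 where
  domain := soloInformedTelT
  integrand := soloInformedZ3s
  isSemialgebraic_domain := isSemialgebraic_soloInformedTelT
  isSemialgebraicFunOn_integrand :=
    soloInformed_isSemialgebraicFunOn_quot3 isSemialgebraic_soloInformedTelT 1
      (X 0 * X 1 * (1 - X 2)) _ (fun t ht => by simpa using (soloInformedZ3s_den_pos ht).ne')
      fun t _ => by simp [soloInformedZ3s]
  integrableOn := by
    rw [← soloInformed_image_telKap, soloInformedTelKap, soloInformed_integrableOn_image_polyMap_iff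
      _ soloInformed_measurableSet_openCube3 soloInformed_injOn_telKap]
    exact soloInformedZ3cRep.integrableOn.congr_fun (fun x hx => (soloInformedZ3s_kap hx).symm)
      soloInformed_measurableSet_openCube3

/-- Both are representations with rational data (the hypothesis class of `KZPeriodConjecture`). -/
theorem soloInformedZ12sRep_isRational : soloInformedZ12sRep.IsRational :=
  ⟨1, X 0 * (1 - X 1) * (1 - X 2),
    fun t ht => by simpa using (soloInformedZ12s_den_pos (t := t) ht).ne',
    fun t _ => by simp [soloInformedZ12sRep, soloInformedZ12s]⟩

/-- Auxiliary (ζ(1,2) = ζ(3)): `soloInformedZ3sRep_isRational`. -/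
theorem soloInformedZ3sRep_isRational : soloInformedZ3sRep.IsRational :=
  ⟨1, X 0 * X 1 * (1 - X 2),
    fun t ht => by simpa using (soloInformedZ3s_den_pos (t := t) ht).ne',
    fun t _ => by simp [soloInformedZ3sRep, soloInformedZ3s]⟩

/-! ## 2. The moves on the `R₂` side -/

/-- **(1b)** `[R₂] − [Z₁₂ᶜ] − [Z₃ᶜ] ∈ relations`. -/
theorem soloInformed_z_move1 :
    of soloInformedTelR2 - of soloInformedZ12cRep - of soloInformedZ3cRep ∈ relations :=
  integrandAddRel_subset_relations ⟨3, soloInformedTelR2, soloInformedZ12cRep, soloInformedZ3cRep,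
    rfl, rfl, fun _ hx => soloInformedTelS_eq_Z12c_add_Z3c hx, rfl⟩

/-- **(2)** `[Z₁₂ᶜ] − [Z₁₂ˢ] ∈ relations` along `κ`. -/
theorem soloInformed_z_move2 : of soloInformedZ12cRep - of soloInformedZ12sRep ∈ relations :=
  soloInformed_of_sub_of_mem_relations_polyMapCLM soloInformedTelKapPoly soloInformedZ12cRep
    soloInformedZ12sRep soloInformed_injOn_telKap soloInformed_image_telKap.symm fun x hx => by
      show soloInformedZ12c x = soloInformedZ12s (soloInformedTelKap x) * _
      rw [mul_comm]; exact (soloInformedZ12s_kap hx).symm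

/-- **(2)** `[Z₃ᶜ] − [Z₃ˢ] ∈ relations` along `κ`. -/
theorem soloInformed_z_move3 : of soloInformedZ3cRep - of soloInformedZ3sRep ∈ relations :=
  soloInformed_of_sub_of_mem_relations_polyMapCLM soloInformedTelKapPoly soloInformedZ3cRep
    soloInformedZ3sRep soloInformed_injOn_telKap soloInformed_image_telKap.symm fun x hx => by
      show soloInformedZ3c x = soloInformedZ3s (soloInformedTelKap x) * _
      rw [mul_comm]; exact (soloInformedZ3s_kap hx).symm

/-! ## 3. The moves on the `R₁` side -/

/-- The two pieces of `R₁`. -/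
def soloInformedTelR1Pieces : Fin 2 → IntegralRep 3 := ![soloInformedTelP1, soloInformedTelP2]

/-- Auxiliary (ζ(1,2) = ζ(3)): `soloInformedTelR1Pieces_zero`. -/
@[simp] theorem soloInformedTelR1Pieces_zero : soloInformedTelR1Pieces 0 = soloInformedTelP1 := rfl
/-- Auxiliary (ζ(1,2) = ζ(3)): `soloInformedTelR1Pieces_one`. -/
@[simp] theorem soloInformedTelR1Pieces_one : soloInformedTelR1Pieces 1 = soloInformedTelP2 := rfl

/-- The wall `D₁ \ (P₁ ∪ P₂) ⊆ {w = yu}` is null. -/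
theorem soloInformed_z_wall_null :
    volume (soloInformedTelD1 \ ⋃ i ∈ (Finset.univ : Finset (Fin 2)),
      (soloInformedTelR1Pieces i).domain) = 0 := by
  refine soloInformed_volume_eq_zero_of_subset_zeroSet3 (X 2 - X 0 * X 1) (fun h => ?_)
    fun x hx => ?_
  · have h1 := congr_arg (MvPolynomial.eval (fun i : Fin 3 => if i = 2 then (1 : ℚ) else 0)) h
    simp at h1
  · have hD := hx.1
    have hnot := hx.2
    simp only [Finset.mem_univ, iUnion_true, mem_iUnion, not_exists] at hnot
    have h0 : ¬ x 2 < x 0 * x 1 := fun hlt => hnot 0 ⟨hD.1, hlt⟩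
    have h1 : ¬ x 0 * x 1 < x 2 := fun hlt => hnot 1 ⟨hD.1, hlt, hD.2⟩
    have heq : x 2 = x 0 * x 1 := le_antisymm (not_lt.1 h1) (not_lt.1 h0)
    simp [heq]

/-- **(1a)** `[R₁] − ([P₁] + [P₂]) ∈ relations`. -/
theorem soloInformed_z_move4 :
    of soloInformedTelR1 - (of soloInformedTelP1 + of soloInformedTelP2) ∈ relations := by
  have h := of_sub_sum_of_mem_relations_of_subset (Finset.univ : Finset (Fin 2)) soloInformedTelR1
    soloInformedTelR1Pieces
    (fun i _ => by
      fin_cases i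
      · exact soloInformedTelP1D_subset
      · exact soloInformedTelP2D_subset)
    (fun i _ => by fin_cases i <;> exact fun _ _ => rfl) soloInformed_z_wall_null
    (fun i _ j _ hij => by
      fin_cases i <;> fin_cases j
      · exact (hij rfl).elim
      · exact disjoint_left.2 fun x (hx : x ∈ soloInformedTelP1D) (hx' : x ∈ soloInformedTelP2D) =>
          lt_asymm (show x 2 < x 0 * x 1 from hx.2) (show x 0 * x 1 < x 2 from hx'.2.1)
      · exact disjoint_left.2 fun x (hx : x ∈ soloInformedTelP2D) (hx' : x ∈ soloInformedTelP1D) =>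
          lt_asymm (show x 0 * x 1 < x 2 from hx.2.1) (show x 2 < x 0 * x 1 from hx'.2)
      · exact (hij rfl).elim)
  simpa [Fin.sum_univ_two] using h

/-- **(2)** `[P₁] − [Z₁₂ˢ] ∈ relations` along `M₁ = (u, yu, w)`. -/
theorem soloInformed_z_move5 : of soloInformedTelP1 - of soloInformedZ12sRep ∈ relations :=
  soloInformed_of_sub_of_mem_relations_polyMapCLM soloInformedTelM1Poly soloInformedTelP1
    soloInformedZ12sRep (soloInformed_injOn_telM1.mono inter_subset_left)
    soloInformed_image_telM1.symm fun x hx => by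
      show soloInformedTelF1 x = soloInformedZ12s (soloInformedTelM1 x) * _
      exact (soloInformedZ12s_m1 hx.1).symm

/-- **(2)** `[P₂] − [Z₁₂ˢ] ∈ relations` along `M₂ = (u, w, yu)`. -/
theorem soloInformed_z_move6 : of soloInformedTelP2 - of soloInformedZ12sRep ∈ relations :=
  soloInformed_of_sub_of_mem_relations_polyMapCLM soloInformedTelM2Poly soloInformedTelP2
    soloInformedZ12sRep (soloInformed_injOn_telM2.mono inter_subset_left)
    soloInformed_image_telM2.symm fun x hx => by
      show soloInformedTelF1 x = soloInformedZ12s (soloInformedTelM2 x) * _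
      exact (soloInformedZ12s_m2 hx.1).symm

/-! ## 4. Euler's relation in `𝒫` -/

/-- **Main theorem (PART XVI, weight 3).** `[Z₁₂ˢ] − [Z₃ˢ] ∈ KZ.relations`: the iterated-integral
representations of `ζ(1,2)` and `ζ(3)` are equivalent under the Kontsevich–Zagier rules
(1a), (1b), (2) — no Newton–Leibniz move is used. -/
theorem soloInformed_zeta12_sub_zeta3_mem_relations :
    of soloInformedZ12sRep - of soloInformedZ3sRep ∈ relations := by
  have e : of soloInformedZ12sRep - of soloInformedZ3sRep =
      (of soloInformedTelR1 - of soloInformedTelR2) -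
        (of soloInformedTelR1 - (of soloInformedTelP1 + of soloInformedTelP2)) -
        (of soloInformedTelP1 - of soloInformedZ12sRep) -
        (of soloInformedTelP2 - of soloInformedZ12sRep) +
        (of soloInformedTelR2 - of soloInformedZ12cRep - of soloInformedZ3cRep) +
        (of soloInformedZ12cRep - of soloInformedZ12sRep) +
        (of soloInformedZ3cRep - of soloInformedZ3sRep) := by abel
  rw [e]
  exact add_mem (add_mem (add_mem (sub_mem (sub_mem (sub_mem soloInformed_telescope
    soloInformed_z_move4) soloInformed_z_move5) soloInformed_z_move6) soloInformed_z_move1)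
    soloInformed_z_move2) soloInformed_z_move3

/-- `ζ(1,2) ≡ ζ(3)` as an equivalence of representations. -/
theorem soloInformed_zeta12_equivalent_zeta3 : Equivalent soloInformedZ12sRep soloInformedZ3sRep :=
  soloInformed_zeta12_sub_zeta3_mem_relations

/-- Soundness corollary: the two absolutely convergent integrals are equal,
`∫_T dt/(t₀(1−t₁)(1−t₂)) = ∫_T dt/(t₀t₁(1−t₂))` (Euler's `ζ(1,2) = ζ(3)`). -/
theorem soloInformed_zeta12_value_eq_zeta3 : soloInformedZ12sRep.value = soloInformedZ3sRep.value :=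
  Equivalent.value_eq_holds soloInformed_zeta12_equivalent_zeta3

/-- The weight-3 MZV instance of the period conjecture holds outright (the value hypothesis is not
even needed). -/
theorem soloInformed_kzp_instance_zeta12_zeta3 :
    soloInformedZ12sRep.IsRational ∧ soloInformedZ3sRep.IsRational ∧
      (soloInformedZ12sRep.value = soloInformedZ3sRep.value →
        Equivalent soloInformedZ12sRep soloInformedZ3sRep) :=
  ⟨soloInformedZ12sRep_isRational, soloInformedZ3sRep_isRational,
    fun _ => soloInformed_zeta12_equivalent_zeta3⟩

end Summit.KontsevichZagierPeriods.KontsevichZagierPeriods.Theorems
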